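import Summits.KontsevichZagierPeriods.KontsevichZagierPeriods.Theorems.RootDecompWalshStrataConicDouble02

/-!
# Root decomposition & Walsh strata — the conic-wall terminal, part 5c: packaging (gen 8, §36.9)

Route `RootDecompWalshStrata`, leaf `QuadricBakerDescent` (stmt-27597), residual R-E2 (NODE.md, decomp-kz-lens-4).
The double-root stratum with the sign splitter, both sides of `y₀` and both branches
(`InBaker.conic_height_double`), and the COMPLETE conic-wall height terminal for `c < 0` — every
radicand stratum (generic, double-root, linear, constant), both branches — `InBaker.conic_height_all'`:
the `h`-input of `InBaker.psection_height` for an adapted conic wall of an E-type sector piece inside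
a rational hull on which `R₄ ≠ 0`. [KontsevichZagier2001 §1.2; this node]
-/

noncomputable section

open Set MeasureTheory Literature.NumberTheory.Transcendental
open Literature.ModelTheory.ExponentialFields (IsSemialgebraic isSemialgebraic_univ)

namespace Summit.KontsevichZagierPeriods.RootDecompWalshStrata.ConicDescent

/-! #### 36.9c Packaging -/

/-- **CONIC-WALL HEIGHT TERMINAL, double-root radicand** (`δe ≠ 0`, `4δeδg = δf²`, `c < 0`; both
branches, both sides of `y₀`). [this node] -/
theorem InBaker.conic_height_double (W : ConicWall) (γ ε : ℚ) (hε : ε = 1 ∨ ε = -1) (hk : W.k ≠ 0)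
    (ha : W.a ≠ 0) (hκ : 0 ≤ W.κ₀ ∧ 0 ≤ W.κ₁) (hc : W.c < 0) (he : W.δe ≠ 0)
    (hdr : 4 * W.δe * W.δg = W.δf ^ 2) (lo hi : ℚ)
    (r : KZ.IntegralRep 1) (hdom : ∀ v ∈ r.domain, (lo : ℝ) ≤ v 0 ∧ v 0 ≤ hi)
    (hδ : ∀ v ∈ r.domain, 0 < W.δ (v 0))
    (hr : EqOn r.integrand (BallCube.pheight W.κ₀ W.κ₁ γ W.a W.c (W.Xb ε) (W.Xb' ε)) r.domain) :
    InBaker (KZ.of r) := by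
  have hSA := r.isSemialgebraic_domain
  have hc' : (W.c : ℝ) < 0 := by exact_mod_cast hc
  have hΛc : ∀ v ∈ r.domain,
      ((W.P (v 0) + ε * W.l₁ * √(W.δ (v 0))) / W.k) ^ 2 - W.c ≠ 0 := fun v _ => by
    nlinarith [sq_nonneg ((W.P (v 0) + ε * W.l₁ * √(W.δ (v 0))) / W.k)]
  -- the wall whose `+`-branch is our branch
  obtain ⟨W', hk', he', hdr', hf', hδ', hl₀, hcc, hΛ'⟩ : ∃ W' : ConicWall,
      W'.k ≠ 0 ∧ W'.δe ≠ 0 ∧ 4 * W'.δe * W'.δg = W'.δf ^ 2 ∧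
      -W'.δf / (2 * W'.δe) = -W.δf / (2 * W.δe) ∧
      (∀ y, W'.δ y = W.δ y) ∧ W'.l₀ = W.l₀ ∧ W'.c = W.c ∧
      ∀ y, W'.Λ y = (W.P y + ε * W.l₁ * √(W.δ y)) / W.k := by
    rcases hε with rfl | rfl
    · exact ⟨W, hk, he, hdr, rfl, fun y => rfl, rfl, rfl, fun y => by
        simp only [ConicWall.Λ]; push_cast; ring⟩
    · exact ⟨W.negl₁, by rwa [W.negl₁_k], by rwa [W.negl₁_δe],
        by rw [W.negl₁_δe, W.negl₁_δg, W.negl₁_δf]; exact hdr, by rw [W.negl₁_δe, W.negl₁_δf],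
        W.negl₁_δ, rfl, rfl, fun y => by rw [W.negl₁_Λ]; push_cast; ring⟩
  refine InBaker.abs_of_signed r
    (fun v => (γ / 3 : ℝ) / (√(W'.δ (v 0)) * (W'.Λ (v 0) ^ 2 - W'.c)))
    (fun v => W'.Λ (v 0) ^ 3 * (W'.l₀ * W'.Λ (v 0) - W'.c)) ?_ (fun v hv => ?_)
    fun s hs r' hsub hr' => ?_
  · have hΛ := W'.isSemialgebraicFunOn_Λ hSA
    exact ((hΛ.mul_holds (hΛ.mul_holds hΛ)).mul_holds
      (((isSemialgebraicFunOn_ratCast hSA W'.l₀).mul_holds hΛ).sub_holds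
        (isSemialgebraicFunOn_ratCast hSA W'.c))).congr fun v _ => by
      simp only [Pi.mul_apply, Pi.sub_apply]; ring
  · rw [hr hv]
    beta_reduce
    rw [W.pheight_Xb γ ε hε hk ha hκ v (hδ v hv) (hΛc v hv), ← hΛ', hδ', hl₀, hcc]
    ring
  · have hr'' : EqOn r'.integrand (fun v => (γ * s / 3 : ℝ) * W'.Λ (v 0) ^ 3 *
        (W'.l₀ * W'.Λ (v 0) - W'.c) / (√(W'.δ (v 0)) * (W'.Λ (v 0) ^ 2 - W'.c))) r'.domain :=
      fun v hv => by rw [hr' hv]; beta_reduce; ring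
    -- split at `y₀`: the two sides `τ = ±1`
    refine InBaker.of_split_at (-W'.δf / (2 * W'.δe)) r' (fun r₂ hd₂ hi₂ => ?_)
      fun r₂ hd₂ hi₂ => ?_
    · refine InBaker.conic_terminal_signed_double W' γ s hk' (by rw [hcc]; exact hc) he' hdr' 1
        (Or.inl rfl) lo hi r₂ (fun v hv => ?_) (fun v hv => ?_) (fun v hv => ?_) fun v hv => ?_
      · rw [hd₂] at hv; exact hdom v (hsub hv.1)
      · rw [hd₂] at hv
        have h : ((-W'.δf / (2 * W'.δe) : ℚ) : ℝ) < v 0 := hv.2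
        push_cast at h ⊢
        linarith
      · rw [hd₂] at hv; rw [hδ']; exact hδ v (hsub hv.1)
      · rw [hi₂]; rw [hd₂] at hv; exact hr'' hv.1
    · refine InBaker.conic_terminal_signed_double W' γ s hk' (by rw [hcc]; exact hc) he' hdr' (-1)
        (Or.inr rfl) lo hi r₂ (fun v hv => ?_) (fun v hv => ?_) (fun v hv => ?_) fun v hv => ?_
      · rw [hd₂] at hv; exact hdom v (hsub hv.1)
      · rw [hd₂] at hv
        have h : v 0 < ((-W'.δf / (2 * W'.δe) : ℚ) : ℝ) := hv.2
        push_cast at h ⊢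
        linarith
      · rw [hd₂] at hv; rw [hδ']; exact hδ v (hsub hv.1)
      · rw [hi₂]; rw [hd₂] at hv; exact hr'' hv.1

/-- **THE COMPLETE CONIC-WALL HEIGHT TERMINAL FOR `c < 0`** (`k ≠ 0`; every radicand stratum —
generic, double-root, linear, constant — and both branches): the `h`-input of
`InBaker.psection_height` for an adapted conic wall of an E-type sector piece inside a rational hull on
which `R₄ ≠ 0`. [this node] -/
theorem InBaker.conic_height_all' (W : ConicWall) (γ ε : ℚ) (hε : ε = 1 ∨ ε = -1) (hk : W.k ≠ 0)
    (ha : W.a ≠ 0) (hκ : 0 < W.κ₀ ∧ 0 ≤ W.κ₁) (hc : W.c < 0) (lo hi : ℚ)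
    (hR4 : ∀ x : ℝ, (lo : ℝ) ≤ x → x ≤ hi → Polynomial.aeval x W.R4Y ≠ 0)
    (r : KZ.IntegralRep 1) (hdom : ∀ v ∈ r.domain, (lo : ℝ) ≤ v 0 ∧ v 0 ≤ hi)
    (hδ : ∀ v ∈ r.domain, 0 < W.δ (v 0))
    (hr : EqOn r.integrand (BallCube.pheight W.κ₀ W.κ₁ γ W.a W.c (W.Xb ε) (W.Xb' ε)) r.domain) :
    InBaker (KZ.of r) := by
  by_cases hd : W.δe ≠ 0 ∧ 4 * W.δe * W.δg = W.δf ^ 2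
  · exact InBaker.conic_height_double W γ ε hε hk ha ⟨hκ.1.le, hκ.2⟩ hc hd.1 hd.2 lo hi r hdom hδ hr
  · refine InBaker.conic_height_all W γ ε hε hk ha hκ (fun he h => hd ⟨he, ?_⟩) lo hi hR4 r hdom
      hδ hr
    have h1 : W.δg = W.δf ^ 2 / (4 * W.δe) := (sub_eq_zero.1 h)
    rw [h1]
    field_simp

end Summit.KontsevichZagierPeriods.RootDecompWalshStrata.ConicDescent

end
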